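import Mathlib
import HarnessLib
import HarnessLib.Audit
import Summits.HodgeConjecture.Statement
import Literature.AlgebraicGeometry.HodgeTheory.HodgeModelExistence
import Literature.AlgebraicGeometry.Motives.AbelianVariety
import Summits.HodgeConjecture.HodgeConjecture.Theorems.NodalSupportHodgeModels

/-!
Route: LosTransfer

Thesis X (UniformEffectivity) — card
HodgeConjecture/HodgeConjecture/los-transfer-uniform-effectivity. It suffices to show: every
rational (p,p)-class c on a smooth projective complex variety X has UNIFORMLY EFFECTIVE REDUCTIONS.
Precisely (the content of the requested predicate HasUniformlyEffectiveReductions n X p c): there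
exist a finitely generated ℤ-algebra R ⊂ ℂ, a smooth projective model f : 𝒳 → S = Spec R of X with a
relatively very ample O(1), a prime ℓ, a global section A of the lisse sheaf R^{2p}f_*ℚ_ℓ(p) over a
finite étale cover of S[1/ℓ] whose fibre at the tautological point Spec ℂ → S is the image of c
under Artin's comparison isomorphism, and integers m ≥ 1, B ≥ 0, such that the set of closed points
s (finite residue fields) for which m·A(s̄) = cl(Z⁺) − cl(Z⁻) with Z⁺, Z⁻ EFFECTIVE codimension-p
cycles on the geometric fibre 𝒳_s̄ of O(1)-degree ≤ B is Zariski-dense in S.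
Why it suffices (TransferTheorem, unconditional): pairs of effective cycles of degree ≤ B live on
the relative Hilbert scheme Hilb_{≤B}(𝒳/S)², of finite type; the ℓ-adic class cl(Z⁺) − cl(Z⁻) − m·A
is a section of a lisse sheaf on it, so it vanishes on whole connected components; the image in S of
those components is constructible (Chevalley), hence contains the generic point as soon as it
contains a dense set of closed points; a K̄-point over the generic point is a cycle on X_K̄ with
ℓ-adic class m·c, hence (Artin comparison, both sides rational) Betti class m·c, so c ∈
algebraicClasses X p. Conversely an algebraic c has uniformly effective reductions (reduce a
representing cycle: degree and class are constant in the flat family). So X ⟺ HodgeConjecture: a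
faithful reformulation (Łoś / van den Dries–Schmidt compactness made geometric) that moves the
construction problem to varieties over FINITE fields — where Frobenius, Tate's theorem,
Honda–Tate/quaternion arithmetic and Langer's moduli of semistable sheaves are available — at the
price of ONE uniformity in the prime. The route's own analysis (rationale) shows the finite-field
side splits into three parts: RATIONALITY of the specialised class (Milne's conjecture), Tate SPAN
(free at supersingular primes of abelian varieties), and the degree UNIFORMITY.
Lean: ∀ ⦃n : ℕ⦄ ⦃X : Literature.AlgebraicGeometry.Motives.SchemeOver ℂ⦄,
Literature.AlgebraicGeometry.Motives.IsSmoothProjective n X → ∀ (p : ℕ) (c :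
Literature.AlgebraicTopology.SingularHomology.singularCohomology ℂ ℂ
(Literature.AlgebraicGeometry.Motives.ComplexPoints X) (2 * p)),
Literature.AlgebraicGeometry.HodgeTheory.IsRationalClass c →
Literature.AlgebraicGeometry.HodgeTheory.IsOfHodgeType n X (2 * p) p p c →
Literature.AlgebraicGeometry.Motives.HasUniformlyEffectiveReductions n X p c
(every constant exists except HasUniformlyEffectiveReductions = DEFINITION REQUEST P1; with an
opaque stand-in the whole item set elaborates, folder Sketch.lean, lean check rc 0.)
## Assembly
(∀ n X, Literature.AlgebraicGeometry.HodgeTheory.nonempty_hodgeModel n X) → TransferTheorem →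
UniformEffectivity → HodgeConjecture — pure logic via hodgeConjectureFor_iff_of_isSmoothProjective
(proved in Sketch.lean as assembly_holds against the stand-in); all mathematical weight sits in
TransferTheorem (support, Lean-heavy, classical) and in the cruxes.

Rationale: WHY THIS LINE. The card's Łoś-transfer mechanism, sharpened: HC(c) ⟺ 'the reductions of c are
effective in bounded degree at a Zariski-dense set of closed points' (TransferTheorem: Chevalley on
bounded relative Hilbert schemes + local constancy of ℓ-adic cycle classes + Artin comparison;
logical ancestor VandendriesSchmidt1984, arithmetic frame Tate1994/Deligne1982HodgeCycles Cor. 6.2).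
Working the mechanism through exposed a gap in the card (and in its audit): the Tate conjecture over
𝔽_q only puts the specialised class c_s in the ℚ_ℓ-SPAN of cycle classes, whereas 'm·c_s = cl(Z⁺) −
cl(Z⁻)' needs c_s in their ℚ-LATTICE — at supersingular primes of an abelian variety (where H^{2p}_ℓ
is spanned by intersections of divisors and hom = num, Tate1966Endomorphisms) the residual statement
is exactly Milne's RATIONALITY CONJECTURE (Milne2009RationalTate §4.1: ⟨γ_0 ∪ δ⟩ ∈ ℚ for Lefschetz
δ; Thm 4.3; implied by HC(CM AV); the rationality statement reduces from all AV to CM AV by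
special-point lifting, Aside 4.6, cf. Kisin2017). So the finite-field side of HC splits into three
named parts — rationality (Milne), Tate span (free at supersingular primes, which CM abelian
varieties have at a set of primes of density ≥ 1/[L^gal:ℚ] by Shimura–Taniyama + Chebotarev, hence
Zariski-dense in Spec O_K[1/N]), and degree UNIFORMITY — glued back to characteristic 0 by the
Transfer theorem. Imports: model theory/compactness (transfer), arithmetic of abelian varieties over
finite fields (Honda–Tate, quaternion Hermitian forms on E^g), moduli of semistable sheaves in mixed
characteristic (Langer2004Semistable, Langer2004Mixed) as the sheaf form of 'bounded degree'.
Calibration ground: all abelian fourfolds (HC known, Markman2025SecantWeil); first open customers: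
Weil-type sixfolds of discriminant ≠ −1 and CM-isolated Weil sixfolds (WeilLocusSixfolds2026),
degenerate CM types in dimension ≥ 5.
RANKED CRUXES. #2 AbelianUniformEffectivity — every Hodge class on a complex abelian variety has
uniformly effective reductions; ⟺ HC for abelian varieties by TransferTheorem
(Deligne1982HodgeCycles Thm 2.11 + Prop 2.9(b) make c_s canonical); attack at SUPERSINGULAR primes
where the Tate part is free and everything is quaternion-Hermitian arithmetic on E^g (why it might
fail: it is HC(AV); every cycle visible at supersingular primes — Frobenius graphs, quaternionic
divisors — has degree growing like a power of p). #3 MilneRationality — Milne's rationality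
conjecture (necessary for #2 and for HC; the route's sharpest refutation instrument: one irrational
pairing ⟨c_s ∪ δ⟩ at one prime kills HC(c); known only for ordinary simple CM reductions, Milne Ex.
4.1). #4 HodgeClassesPotentiallyTate — Hodge classes are fixed ℓ-adically by an open subgroup of
Gal(K̄/K) over a finitely generated field of definition (the Galois half of CharlesSchnell2014Notes
Conj. 11.2.17; theorem for abelian motives by Deligne; needed to make c_s canonical beyond abelian
type; necessary for HC).
KILL CRITERIA. (i) A proved instance of ¬MilneRationality (an irrational or ℓ-dependent pairing for
a Hodge class on a CM abelian variety) refutes HodgeConjecture itself — close every Hodge route, not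
just this one. (ii) If, for a class KNOWN to be algebraic (Weil classes on a CM abelian fourfold,
Markman2025SecantWeil), the minimal degree of a Lefschetz/quaternionic presentation of m·c_s at
these supersingular primes is shown unbounded in p, the supersingular strategy for #2 is dead
(uniform effectivity then holds only through reductions of the char-0 cycle, i.e. with no
finite-field leverage) → close as 'reformulation without leverage'. (iii) If TransferTheorem needs
hypotheses beyond those in P1 (e.g. fails for torsion phenomena not absorbed by m), restate P1; not
a kill.
NOT DECOMPOSED YET. No split of #2 into [Chebotarev supersingular density for CM types] →
[BoundedLefschetzPresentation: m·c_s lies in the ℤ-span of monomials in divisor classes of bounded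
degree on A_s̄ for infinitely many supersingular s] → [CM ⟹ all AV: open, bounded-degree closedness
along the CM-dense Hodge locus]; no K3×K3 analogue (supersingular K3 reductions, Charles2014PicardK3
degree growth as the negative calibration); no item for the Langer regularity bound itself (it rides
inside SemistableTypeCriterion); no ¬-statements filed (¬MilneRationality would be filed only with a
concrete candidate pairing).
CHEAPEST FALSIFIER. Take a CM abelian fourfold A with EXCEPTIONAL Weil classes from the
Moonen–Zarhin list — e.g. Mumford's simple CM fourfold (catalogue
Mumford1968_simpleFourfold_exceptionalHodgeClasses: CM field L ⊃ K = ℚ(√−d) acting with signature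
(2,2)); NOT E⁴ for a CM elliptic curve E, whose Hodge ring is generated by divisors — and the primes
p whose Frobenius in Gal(L^gal/ℚ) is complex conjugation (supersingular reduction, A_p̄ isogenous to
E_p⁴, End⁰ = M₄(B_{p,∞})). For the five smallest such p compute, by quaternion-Hermitian linear
algebra in N²(A_p̄)_ℚ: (a) the pairings of the specialised Betti Weil classes with Lefschetz classes
— they must be rational and ℓ-independent (HC is KNOWN for abelian fourfolds, Markman2025SecantWeil;
an irrationality exposes an error in the set-up, a confirmed one would refute HC); (b) the minimal
O(1)-degree of an effective presentation of m·(Weil class)_p: visible growth with p already here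
fires kill criterion (ii). kit-sized (CM periods of A are explicit, the specialisation is computable
through the crystalline–de Rham comparison for CM abelian varieties).
TWO-LAYER PLAN. Foreseen glued split of #2 (k = 3): SupersingularDensityCM →
BoundedLefschetzPresentation ⟹ AbelianUniformEffectivity restricted to CM abelian varieties, then
CMToAllAbelian (open: needs a degree bound uniform along the CM-dense Hodge locus; shared territory
with cards degree-spectroscopy-hecke-orbit / uniform-effectivity-arithmetisation); of the target (k
= 2): HodgeClassesPotentiallyTate ∧ UniformEffectivityForPotentiallyTateClasses ⟹
UniformEffectivity.
SUPPORT. TransferTheorem (↔; classical ingredients, Lean-heavy: relative Hilbert schemes of bounded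
degree, lisse R^{2p}f_*ℚ_ℓ, specialisation, Artin comparison); SemistableTypeCriterion (the card's
Langer engine, corrected per audit: c has uniformly effective reductions iff at a dense set of
closed points m·c_s ≡ c_p(E_s) modulo ℚ[h]·(specialised lower algebraic classes) for
slope-semistable torsion-free E_s of p-INDEPENDENT numerical type ν — Langer's boundedness makes
M(ν) → S of finite type, then Chevalley; the regularity/global-generation step of the card is
unnecessary).
DEFINITION REQUESTS. P1 HasUniformlyEffectiveReductions n X p c
(Literature/AlgebraicGeometry/Motives; as in the thesis). P2 MilneRationalityConjecture : Prop
(Milne2009RationalTate §4.1, adelic form). P3 HasSemistableRepresentativesOfFixedType n X p c (as in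
SUPPORT). P4 HodgeClassesArePotentiallyTate n X (every rational (p,p)-class on X is fixed, in
H^{2p}_et(X, ℚ_ℓ(p)), by an open subgroup of Gal(K̄/K) for some finitely generated field of
definition K). All four filed as definition items against this route; every item is typed modulo
them and elaborates with opaque stand-ins (Sketch.lean rc 0).
SOURCES. Deligne1982HodgeCycles (Prop 2.9(b) p.20, Thm 2.11 p.21, Cor 6.2 p.47 of the held text
paper:galaxy-pdf-8405055998839152860); Milne2009RationalTate (§4.1, Thm 4.3, Ex 4.1, Rem 4.5, Aside
4.6; held paper:arxiv-0707.3167 p.18–19); Tate1966Endomorphisms; Tate1994; VandendriesSchmidt1984;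
Langer2004Semistable; Langer2004Mixed; Kisin2017; Markman2025SecantWeil; WeilLocusSixfolds2026;
Charles2014PicardK3; arXiv:1909.07473; arXiv:2003.11037; arXiv:2410.21010; CharlesSchnell2014Notes
Conj. 11.2.17.

Novelty: Searches run (2026-08-15): zbMATH 'Milne rational Tate classes' (found Milne2009RationalTate =
arXiv:0707.3167, read §4 pp.18–19), 'Langer semistable sheaves positive characteristic boundedness'
/ 'moduli spaces of sheaves in mixed characteristic' (doi:10.4007/annals.2004.159.251,
doi:10.1215/s0012-7094-04-12434-0), 'Markman Hodge conjecture abelian fourfolds Weil type'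
(arXiv:2502.03415 read pp.2–3; arXiv:2504.13607; arXiv:2108.02087), 'van den Dries Schmidt bounds
polynomial rings' (doi:10.1007/bf01388493), 'Kisin mod p points Shimura varieties abelian type'
(doi:10.1090/jams/867), 'Charles Picard number K3 number fields' (arXiv:1111.4117,
arXiv:1909.07473), 'Hodge classes reduction modulo p algebraic' (5 hits: Langlands–Rapoport 1987,
Serre 1994 — none on transfer), 'ultraproduct algebraic cycles Hodge conjecture finite fields' (0),
'specialization Hodge classes supersingular reduction Lefschetz rationality' (0); lit frontier
HodgeConjecture --since 2020 (arXiv:2410.21010 uniform bounds for INTEGRAL Tate obstructions;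
arXiv:2603.20268 read pp.1–3); lit galaxy search --star all 'rational Tate classes' /
'specialization of Hodge classes … uniform degree … lifting' (0 rows, service degraded, logged);
local searchd unreachable all session (rc 75). Card-level searches (bm25 galaxy: only Costa–Sertöz
arXiv:2003.11037 on point) and the refuter audit (van den Dries–Schmidt, Tate 1994) stand. Nearest
prior art FOUND: (a) Milne2009RationalTate — isolates the RATIONALITY of specialis  [refs: 10.4007/annals.2004.159.251, 10.1215/s0012-7094-04-12434-0, 10.1007/bf01388493, 10.1090/jams/867, 0707.3167, 2502.03415, 2504.13607, 2108.02087, 1111.4117, 1909.07473, 2410.21010, 2603.20268, 2003.11037, doi:10.4007/annals.2004.159.251, doi:10.1215/s0012-7094-04-12434-0, doi:10.1007/bf01388493, doi:10.1090/jams/867, Tate1994, VandendriesSchmidt1984]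

Barriers (technique_class: reduction-mod-p, uniform-effectivity, abelian-varieties): - technique_class: reduction-mod-p, uniform-effectivity, abelian-varieties
- Literature.Barriers.HodgeConjecture.Serre1964_conjugateVarieties_notHomeomorphic: no Betti class
is transported along Aut(ℂ) or to characteristic p by topology; c travels only through Artin's
comparison on X_ℂ itself and then as a section of the lisse ℓ-adic sheaf of an algebraic family
(this is why P1 quantifies over a global section A and why crux #4 is filed: without potential
Tate-ness c_s is not even well defined).
- Literature.Barriers.HodgeConjecture.Charles2009_conjugateVarieties_cohomologyAlgebrasNotIso: same
evasion; the rational structure used on H_ℓ(X_s̄) is the CYCLE lattice of the special fibre, never a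
transported Betti lattice — and the discrepancy between the two ℚ-structures is made an explicit
crux (MilneRationality) instead of being assumed away.
- Literature.Barriers.HodgeConjecture.hodgeClassesAreAbsoluteFor_abelianVariety: a refutation-side
no-go (no Galois-conjugation counterexample on abelian varieties); used POSITIVELY here — Deligne's
theorem is what makes c_s canonical for abelian varieties, so crux #2 needs no unproved invariance
input; the route's refutation instrument on abelian varieties is a different one (irrational
specialised pairings, crux #3), which absoluteness does not exclude.
- Literature.Barriers.HodgeConjecture.Andre1996_hodgeClassesOnAbelianVarieties_motivated: also
refutation-side; consistent — motivated classes specialise to motivated classes, but algebr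

Novelty grade: new-combination — ROUTE REVIEW gen 3 (refuter ed682e6b-g3; 5th pass; record REVIEW4_LosTransfer.md on stmt-2398; deltas only). VERDICT: CONCUR gen 2 — keep OPEN but dormant until P1 lands; novelty unchanged. STATE 14:50Z: P1 HasUniformlyEffectiveReductions still absent (grep: docstrings only) ⇒ 2398/2399/2400/2403/24 (refuter refuter-rreview-route-HubbardSuperconduc-ed682e6b-g3-0, 2026-08-15T14:41:17Z; prior: Milne2009RationalTate, VandendriesSchmidt1984, Tate1994, Deligne1982HodgeCycles, Langer2004Semistable, Kisin2017, arXiv:2003.11037, arXiv:2410.21010)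

sub-problem: HodgeConjecture · status: done · opened planner-plancard-HodgeConjecture-HodgeConject-2498d4b6-0 2026-08-15T11:03:47Z · rev 0 · ledger route-HodgeConjecture-LosTransfer
GENERATED by the gate from the ledger (D-0016/17). Provers cite these decls: `theorem foo : Summit.HodgeConjecture.HodgeConjecture.Theses.LosTransfer.<Decl> := …` in Summits/HodgeConjecture/HodgeConjecture/Theorems/<Name>.lean.
-/

namespace Summit.HodgeConjecture.HodgeConjecture.Theses.LosTransfer

open scoped BigOperators Topology Manifold Classical MeasureTheory ProbabilityTheory Matrix InnerProductSpace ComplexConjugate ContinuousMap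
open Filter Set Function TopologicalSpace MeasureTheory

attribute [summit_statement] _root_.HodgeConjecture

-- TODO item stmt-HodgeConjecture-2398 · target · rank 0 · open · by planner — BLOCKED: missing decl(s) Literature.AlgebraicGeometry.Motives.HasUniformlyEffectiveReductions; restate via `ledger route edit` once they land:
--   def UniformEffectivity : Prop := ∀ ⦃n : ℕ⦄ ⦃X : Literature.AlgebraicGeometry.Motives.SchemeOver ℂ⦄, Literature.AlgebraicGeometry.Motives.IsSmoothProjective n X → ∀ (p : ℕ) (c : Literature.AlgebraicTopology.SingularHomology.singularCohomology ℂ ℂ (Literature.AlgebraicGeometry.Motives.ComplexPoints X) (2 * p)), Literature.AlgebraicGe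

-- TODO item stmt-HodgeConjecture-2400 · crux · rank 2 · open · by planner — BLOCKED: missing decl(s) Literature.AlgebraicGeometry.Motives.HasUniformlyEffectiveReductions; restate via `ledger route edit` once they land:
--   def AbelianUniformEffectivity : Prop := ∀ (A : Literature.AlgebraicGeometry.Motives.AbelianVariety ℂ), Literature.AlgebraicGeometry.Motives.IsSmoothProjective A.dim A.X → ∀ (p : ℕ) (c : Literature.AlgebraicTopology.SingularHomology.singularCohomology ℂ ℂ (Literature.AlgebraicGeometry.Motives.ComplexPoints A.X) (2 * p)), Literature.Algebra

-- TODO item stmt-HodgeConjecture-2401 · crux · rank 3 · open · by planner — BLOCKED: missing decl(s) Literature.AlgebraicGeometry.Motives.MilneRationalityConjecture; restate via `ledger route edit` once they land: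
--   def MilneRationality : Prop := Literature.AlgebraicGeometry.Motives.MilneRationalityConjecture

-- TODO item stmt-HodgeConjecture-2402 · crux · rank 4 · open · by planner — BLOCKED: missing decl(s) Literature.AlgebraicGeometry.Motives.HodgeClassesArePotentiallyTate; restate via `ledger route edit` once they land:
--   def HodgeClassesPotentiallyTate : Prop := ∀ (E : ∀ (K : Subfield ℂ) (ℓ : ℕ) [Fact ℓ.Prime], Literature.AlgebraicGeometry.Motives.EtaleRealization K ℓ) (B : Literature.AlgebraicGeometry.Motives.BettiHodgeData ℂ) (C : ∀ (K : Subfield ℂ) (ℓ : ℕ) [Fact ℓ.Prime], Literature.AlgebraicGeometry.Motives.ArtinComparison (E K ℓ) B K.subtype), ∀ ⦃n : ℕ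

/-- item stmt-HodgeConjecture-1943 · support · rank 9 · closed · proved by Summit.HodgeConjecture.HodgeConjecture.Theorems.nodalSupport_hodgeModels_proof @ 6468568b8792 (prover) · by planner
[support] needs-fact: Literature.AlgebraicGeometry.HodgeTheory.nonempty_hodgeModel (route-repair,
cone guardrail 2026-08-15). GENUINELY needed: `Nonempty (HodgeModel n X)` is conjunct 1 of
HodgeTheory.HodgeConjectureFor, i.e. part of the summit statement itself, so every route to
HodgeConjecture must produce it. This decl is VERBATIM the first antecedent of this route's Assembly
(and of NodalSupport's and QbarEnvelope's — re-ask this exact signature there to share the item); it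
is filed as an item so that the closing chain is items-only (`Assembly_holds HodgeModels_holds
IsoInvariance_holds VariationalHodge_holds AnchorExistence_holds : HodgeConjecture` typechecks with
no unfolding; planner Sketch.lean rc 0, where `HodgeModels ↔ ∀ n X, IsSmoothProjective n X →
Nonempty (HodgeModel n X)` is Iff.rfl) and so that the fact is named in the ledger as tier-0 debt of
the summit. HOW IT CLOSES: one line, `fun n X => nonempty_hodgeModel_holds`, once the Literature
fact is discharged — the reduction is already in tree:
HodgeModelExistenceDischarge.nonempty_hodgeModel_of_deRham_of_hodgeDecomposition (remaining leaves:
the real de Rham theorem exists_deRhamIsoFamily and the Hodge decomposition -/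
@[route_item "route-HodgeConjecture-LosTransfer"]
def HodgeModels : Prop :=
  ∀ (n : ℕ) (X : Literature.AlgebraicGeometry.Motives.SchemeOver ℂ), Literature.AlgebraicGeometry.HodgeTheory.nonempty_hodgeModel n X

/-- `HodgeModels` holds: proved by `Summit.HodgeConjecture.HodgeConjecture.Theorems.nodalSupport_hodgeModels_proof` @ 6468568b8792. -/
theorem HodgeModels_holds : HodgeModels := _root_.Summit.HodgeConjecture.HodgeConjecture.Theorems.nodalSupport_hodgeModels_proof

-- TODO item stmt-HodgeConjecture-2403 · support · rank 9 · open · by planner — BLOCKED: missing decl(s) Literature.AlgebraicGeometry.Motives.HasUniformlyEffectiveReductions; restate via `ledger route edit` once they land: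
--   def TransferTheorem : Prop := ∀ ⦃n : ℕ⦄ ⦃X : Literature.AlgebraicGeometry.Motives.SchemeOver ℂ⦄, Literature.AlgebraicGeometry.Motives.IsSmoothProjective n X → ∀ (p : ℕ) (c : Literature.AlgebraicTopology.SingularHomology.singularCohomology ℂ ℂ (Literature.AlgebraicGeometry.Motives.ComplexPoints X) (2 * p)), Literature.AlgebraicGe

-- TODO item stmt-HodgeConjecture-2404 · support · rank 9 · open · by planner — BLOCKED: missing decl(s) Literature.AlgebraicGeometry.Motives.HasSemistableRepresentativesOfFixedType, Literature.AlgebraicGeometry.Motives.HasUniformlyEffectiveReductions; restate via `ledger route edit` once they land: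
--   def SemistableTypeCriterion : Prop := ∀ ⦃n : ℕ⦄ ⦃X : Literature.AlgebraicGeometry.Motives.SchemeOver ℂ⦄, Literature.AlgebraicGeometry.Motives.IsSmoothProjective n X → ∀ (p : ℕ) (c : Literature.AlgebraicTopology.SingularHomology.singularCohomology ℂ ℂ (Literature.AlgebraicGeometry.Motives.ComplexPoints X) (2 * p)), Literature.AlgebraicGe

-- TODO item stmt-HodgeConjecture-2399 · assembly · rank 1 · open · by planner — BLOCKED: missing decl(s) Literature.AlgebraicGeometry.Motives.HasUniformlyEffectiveReductions; restate via `ledger route edit` once they land: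
--   def Assembly : Prop := (∀ (n : ℕ) (X : Literature.AlgebraicGeometry.Motives.SchemeOver ℂ), Literature.AlgebraicGeometry.HodgeTheory.nonempty_hodgeModel n X) → (∀ ⦃n : ℕ⦄ ⦃X : Literature.AlgebraicGeometry.Motives.SchemeOver ℂ⦄, Literature.AlgebraicGeometry.Motives.IsSmoothProjective n X → ∀ (p : ℕ) (c : Literature.Algebrai

end Summit.HodgeConjecture.HodgeConjecture.Theses.LosTransfer
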